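import Mathlib.Combinatorics.SimpleGraph.Coloring.Vertex
import Mathlib.RingTheory.AdjoinRoot
import Mathlib.Algebra.MvPolynomial.CommRing
import Mathlib.Algebra.MvPolynomial.Eval
import Mathlib.RingTheory.Ideal.Quotient.Operations
import Mathlib.Data.ZMod.Basic
import Mathlib.Algebra.Polynomial.Div
import Mathlib.Tactic.ComputeDegree
import Mathlib.Tactic.FinCases
import Mathlib.Tactic.LinearCombination
import HarnessLib

/-!
# The Moser ring `ℤ[1/3][ζ₆, (1+√33)/2]` reduces onto `F₄`: every unit-distance graph built from it is 4-colourable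

Framing (verbatim for the cell): lottery ticket; floor = certified bounds/negative ranges.

Census file of the (U) seat (pub-namedobj-udg-g2, `MOSER-FIELD.md`).  All of de Grey's base graphs and Heule's `V₃₁, V₁₅₁, V₁₉₃₉, S₁₉₉,
T₂₅₉, G₂₁₆₇` have their vertices — read as complex numbers `z = x + iy` — in the ring
`B = ℤ[1/3][ζ₆, δ]`, `ζ₆ = e^{iπ/3}`, `δ = (1 + √33)/2` (e.g. `θ₃^{1/2} = (δ + ζ₆ − 1)/3`, `i√3 = 2ζ₆ − 1`,
`i√11 = (2ζ₆ − 1)(2δ − 1)/3`), a subring of the "Moser field" `ℚ(√3, √11, i) ⊃ ℚ(√3,√11)²`.  Complex conjugation acts on `B`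
by `σ(ζ₆) = 1 − ζ₆`, `σ(δ) = δ`, and two vertices are at Euclidean distance `1` iff `u = z − w` satisfies `u·σ(u) = 1`.
We present `B` by generators and relations (`MoserRing`), construct `σ` (`moserConj`) and a ring homomorphism
`moserToF4 : B →+* F₄` (`ζ₆ ↦ ω`, `δ ↦ 0`, `1/3 ↦ 1`; this is reduction modulo one of the two primes of `ℚ(√3,√11,i)`
above `2`), and prove the purely algebraic THEOREM `colorable_four_of_moserRing`: any graph whose vertices carry
`B`-labels with `u·σ(u) = 1` along every edge is 4-colourable — because `ρ(u)·ρ(σu) = ρ(1) = 1` forces `ρ(u) ≠ 0`, so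
`ρ ∘ labels` is a proper colouring into `F₄`, which has (at most) four elements.  This is the machine-checked core of the
candidate theorem `χ(ℚ(√3,√11)²) = 4` of `MOSER-FIELD.md` (the passage from `B`-labelled graphs to all of `ℚ(√3,√11)²` is the
valuation argument there, not formalised here; the lower bound is the Moser spindle).  Nothing here is literature.
-/

noncomputable section

namespace Summit.Ventures.DiscreteObjects.UnitDistance

open Polynomial SimpleGraph

/-! ### A concrete `F₄ = F₂[X]/(X² + X + 1)` -/

/-- `X² + X + 1 ∈ F₂[X]`. -/
def f4poly : Polynomial (ZMod 2) := X ^ 2 + X + 1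

/-- `X² + X + 1` is monic. -/
theorem f4poly_monic : f4poly.Monic := by
  unfold f4poly; monicity!

/-- `X² + X + 1` has degree `2`. -/
theorem f4poly_natDegree : f4poly.natDegree = 2 := by
  unfold f4poly; compute_degree!

/-- `X² + X + 1 ≠ 1`. -/
theorem f4poly_ne_one : f4poly ≠ 1 := by
  intro h
  have := congrArg Polynomial.natDegree h
  rw [f4poly_natDegree, natDegree_one] at this
  exact absurd this (by norm_num)

/-- The field with four elements, presented as `F₂[X]/(X² + X + 1)`. -/
abbrev F4 : Type := AdjoinRoot f4poly

/-- `ω := X mod (X² + X + 1)`, a primitive cube root of unity in `F₄`. -/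
def omegaF4 : F4 := AdjoinRoot.root f4poly

/-- `ω² + ω + 1 = 0`. -/
theorem omegaF4_rel : omegaF4 ^ 2 + omegaF4 + 1 = 0 := by
  have h := AdjoinRoot.eval₂_root f4poly
  simp only [f4poly, eval₂_add, eval₂_X_pow, eval₂_X, eval₂_one] at h
  unfold omegaF4
  exact h

/-- `2 = 0` in `F₄`. -/
theorem two_eq_zero_F4 : (2 : F4) = 0 := by
  rw [show (2 : F4) = AdjoinRoot.of f4poly 2 from (map_ofNat (AdjoinRoot.of f4poly) 2).symm,
    show (2 : ZMod 2) = 0 by decide, map_zero]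

/-- `F₄` is nontrivial (`X² + X + 1` is not a unit). -/
instance F4.instNontrivial : Nontrivial F4 := by
  refine Ideal.Quotient.nontrivial_iff.mpr ?_
  rw [Ne, Ideal.span_singleton_eq_top, f4poly_monic.isUnit_iff]
  exact f4poly_ne_one

/-- Every element of `F₄` is `a + b·ω` with `a b : F₂`. -/
theorem F4.exists_coeffs (x : F4) :
    ∃ a b : ZMod 2, x = AdjoinRoot.of f4poly a + AdjoinRoot.of f4poly b * omegaF4 := by
  induction x using AdjoinRoot.induction_on with
  | ih p =>
    have hdeg : (p %ₘ f4poly).natDegree ≤ 1 := by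
      have h := Polynomial.natDegree_modByMonic_lt p f4poly_monic f4poly_ne_one
      rw [f4poly_natDegree] at h
      omega
    have hp : AdjoinRoot.mk f4poly p = AdjoinRoot.mk f4poly (p %ₘ f4poly) := by
      rw [AdjoinRoot.mk_eq_mk]
      refine ⟨p /ₘ f4poly, ?_⟩
      have := Polynomial.modByMonic_add_div p f4poly
      linear_combination (-1 : Polynomial (ZMod 2)) * this
    refine ⟨(p %ₘ f4poly).coeff 0, (p %ₘ f4poly).coeff 1, ?_⟩
    rw [hp]
    conv_lhs => rw [Polynomial.eq_X_add_C_of_natDegree_le_one hdeg]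
    simp [omegaF4, AdjoinRoot.mk_X, map_add, map_mul, AdjoinRoot.mk_C]
    ring

/-- `F₄` is finite … -/
instance F4.instFintype : Fintype F4 := by
  classical
  exact Fintype.ofSurjective
    (fun ab : ZMod 2 × ZMod 2 => AdjoinRoot.of f4poly ab.1 + AdjoinRoot.of f4poly ab.2 * omegaF4)
    (fun x => by obtain ⟨a, b, h⟩ := F4.exists_coeffs x; exact ⟨(a, b), h.symm⟩)

/-- … with at most four elements (in fact exactly four; `≤` is what the colouring needs). -/
theorem F4.card_le_four : Fintype.card F4 ≤ 4 := by
  classical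
  have h := Fintype.card_le_of_surjective
    (fun ab : ZMod 2 × ZMod 2 => AdjoinRoot.of f4poly ab.1 + AdjoinRoot.of f4poly ab.2 * omegaF4)
    (fun x => by obtain ⟨a, b, h⟩ := F4.exists_coeffs x; exact ⟨(a, b), h.symm⟩)
  simpa using h

/-! ### The Moser ring `B = ℤ[x₀, x₁, x₂]/(x₀² − x₀ + 1, x₁² − x₁ − 8, 3x₂ − 1)` (`x₀ = ζ₆`, `x₁ = δ = (1+√33)/2`, `x₂ = 1/3`) -/

open MvPolynomial

/-- The three defining relations of the Moser ring. -/
def moserRel : Fin 3 → MvPolynomial (Fin 3) ℤ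
  | 0 => X 0 ^ 2 - X 0 + 1
  | 1 => X 1 ^ 2 - X 1 - MvPolynomial.C 8
  | 2 => MvPolynomial.C 3 * X 2 - 1

/-- The ideal of relations. -/
def moserIdeal : Ideal (MvPolynomial (Fin 3) ℤ) := Ideal.span (Set.range moserRel)

/-- The Moser ring `B = ℤ[1/3][ζ₆, (1+√33)/2]` by generators and relations. -/
abbrev MoserRing : Type := MvPolynomial (Fin 3) ℤ ⧸ moserIdeal

/-- The class of the generator `xᵢ` in `B`. -/
def mgen (i : Fin 3) : MoserRing := Ideal.Quotient.mk moserIdeal (X i)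

/-- Each defining relation vanishes in the quotient `B`. -/
theorem moserRel_mk_eq_zero (i : Fin 3) : Ideal.Quotient.mk moserIdeal (moserRel i) = 0 :=
  Ideal.Quotient.eq_zero_iff_mem.2 (Ideal.subset_span ⟨i, rfl⟩)

/-- `ζ₆² − ζ₆ + 1 = 0` in `B`. -/
theorem mgen0_rel : mgen 0 ^ 2 - mgen 0 + 1 = 0 := by
  have h := moserRel_mk_eq_zero 0
  simpa [moserRel, mgen, map_sub, map_add, map_pow, map_one] using h

/-- `δ² − δ − 8 = 0` in `B`. -/
theorem mgen1_rel : mgen 1 ^ 2 - mgen 1 - 8 = 0 := by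
  have h := moserRel_mk_eq_zero 1
  simpa [moserRel, mgen, map_sub, map_pow, map_ofNat] using h

/-- `3·(1/3) − 1 = 0` in `B`. -/
theorem mgen2_rel : 3 * mgen 2 - 1 = 0 := by
  have h := moserRel_mk_eq_zero 2
  simpa [moserRel, mgen, map_sub, map_mul, map_one, map_ofNat] using h

/-! ### Reduction `ρ : B →+* F₄` modulo a prime above 2 (`ζ₆ ↦ ω`, `δ ↦ 0`, `1/3 ↦ 1`) -/

/-- Images of the generators in `F₄`. -/
def gensF4 : Fin 3 → F4 := ![omegaF4, 0, 1]

/-- The relations hold in `F₄` under `ζ₆ ↦ ω`, `δ ↦ 0`, `1/3 ↦ 1` (so `ρ` is well defined). -/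
theorem eval_moserRel_F4 (i : Fin 3) : eval₂Hom (Int.castRingHom F4) gensF4 (moserRel i) = 0 := by
  fin_cases i
  · simp [moserRel, gensF4]
    linear_combination omegaF4_rel - omegaF4 * two_eq_zero_F4
  · simp [moserRel, gensF4]
    linear_combination (4 : F4) * two_eq_zero_F4
  · simp [moserRel, gensF4]
    linear_combination two_eq_zero_F4

/-- `ρ`: reduction of the Moser ring modulo the prime above 2 with `δ ≡ 0`. -/
def moserToF4 : MoserRing →+* F4 :=
  Ideal.Quotient.lift moserIdeal (eval₂Hom (Int.castRingHom F4) gensF4) (by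
    intro a ha
    refine (Ideal.span_le (I := RingHom.ker (eval₂Hom (Int.castRingHom F4) gensF4))).2 ?_ ha
    rintro _ ⟨i, rfl⟩
    exact eval_moserRel_F4 i)

/-! ### Complex conjugation `σ : B →+* B` (`ζ₆ ↦ 1 − ζ₆`, `δ ↦ δ`, `1/3 ↦ 1/3`) -/

/-- Images of the generators under conjugation. -/
def gensConj : Fin 3 → MoserRing := ![1 - mgen 0, mgen 1, mgen 2]

/-- The relations are preserved by `ζ₆ ↦ 1 − ζ₆`, `δ ↦ δ`, `1/3 ↦ 1/3` (so `σ` is well defined). -/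
theorem eval_moserRel_conj (i : Fin 3) :
    eval₂Hom ((Ideal.Quotient.mk moserIdeal).comp MvPolynomial.C) gensConj (moserRel i) = 0 := by
  fin_cases i
  · simp [moserRel, gensConj]
    linear_combination mgen0_rel
  · simp [moserRel, gensConj]
    linear_combination mgen1_rel
  · simp [moserRel, gensConj]
    linear_combination mgen2_rel

/-- `σ`: the involution of `B` induced by complex conjugation. -/
def moserConj : MoserRing →+* MoserRing :=
  Ideal.Quotient.lift moserIdeal (eval₂Hom ((Ideal.Quotient.mk moserIdeal).comp MvPolynomial.C) gensConj) (by
    intro a ha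
    refine (Ideal.span_le (I := RingHom.ker (eval₂Hom ((Ideal.Quotient.mk moserIdeal).comp MvPolynomial.C) gensConj))).2 ?_ ha
    rintro _ ⟨i, rfl⟩
    exact eval_moserRel_conj i)

/-! ### The theorem -/

/-- KEY STEP: if `u·σ(u) = 1` in `B` then `ρ(u) ≠ 0` in `F₄` (apply the ring homomorphism `ρ` to the identity). -/
theorem moserToF4_ne_zero_of_mul_conj {u : MoserRing} (hu : u * moserConj u = 1) : moserToF4 u ≠ 0 := by
  intro h0
  have h := congrArg moserToF4 hu
  rw [map_mul, map_one, h0, zero_mul] at h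
  exact zero_ne_one h

/-- MAIN THEOREM (machine-checked core of `χ(ℚ(√3,√11)²) = 4`): let the vertices of `G` carry labels `p v` in the Moser ring
`B` such that along every edge the difference `u = p v − p w` satisfies `u·σ(u) = 1` (Euclidean length `1` of the complex number
`u`). Then `G` is 4-colourable: `v ↦ ρ(p v) ∈ F₄` is a proper colouring. -/
theorem colorable_four_of_moserRing {V : Type*} {G : SimpleGraph V} (p : V → MoserRing)
    (hadj : ∀ ⦃v w : V⦄, G.Adj v w → (p v - p w) * moserConj (p v - p w) = 1) : G.Colorable 4 := by
  classical
  have C : G.Coloring F4 := Coloring.mk (fun v => moserToF4 (p v)) (by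
    intro v w hvw heq
    have hne := moserToF4_ne_zero_of_mul_conj (hadj hvw)
    apply hne
    rw [map_sub, sub_eq_zero]
    exact heq)
  exact (C.colorable).mono F4.card_le_four

end Summit.Ventures.DiscreteObjects.UnitDistance

end
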